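import Summits.AtomisticToContinuum.HydrodynamicLimit.Theses.JParityClosure

/-!
# Repair C′ of crux `JParityClosure.OddContactSymmetry` (stmt-AtomisticToContinuum-13078): compactly velocity-supported marks

Lead prover `prover-line-stmt-AtomisticToContinuum-13078-r-0`, 2026-08-16.  Companion of
`Cruxes/OddContactSymmetry/BlowupAnalysis.md`: the crux as filed is not tight (velocity-hole blow-up of the untruncated
reweighting `1 + e^{−F}` for marks that do not vanish at large velocities).  The minimal repair keeps the statement
VERBATIM and adds one hypothesis on the mark `Ψ(n̂, v, w)`: it vanishes when `‖v‖ + ‖w‖` is large.  Then every contributing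
collision has bounded in/outgoing velocities, where the `(r, ϑ)`-mollified empirical law concentrates at its smooth
limit as `N → ∞`, so `e^{−F}` stays bounded w.h.p. and the statistic is tight; the parity content (the J-odd part of the
limit contact correlation vanishes) is unchanged, since compactly supported odd marks separate it.

* `OddContactSymmetryCompactMarks` — the repaired statement C′ (checked to elaborate; `sorry`-free definitions only).
* `oddContactSymmetry_imp_compactMarks` — C′ is WEAKER than the filed crux (so everything proved towards C′'s stubs on the
  truncated / tube objects transfers, and a proof of the filed crux — if it existed — would give C′).
-/

namespace Summit.AtomisticToContinuum.HydrodynamicLimit.Cruxes.OddContactSymmetry.Repair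

open Summit.AtomisticToContinuum.HydrodynamicLimit.Theses.JParityClosure
open Literature.Analysis.FluidPDE Literature.MathematicalPhysics.KineticTheory
open scoped InnerProductSpace BigOperators
open MeasureTheory

noncomputable section

/-- **C′: `OddContactSymmetry` for compactly velocity-supported marks.**  Verbatim the route declaration
`JParityClosure.OddContactSymmetry`, with the single extra hypothesis
`(∃ R : ℝ, ∀ q, R ≤ ‖q.2.1‖ + ‖q.2.2‖ → Ψ q = 0)` on the mark (inserted after its boundedness). [folklore] -/
def OddContactSymmetryCompactMarks : Prop :=
  ∃ η₀ : ℝ, 0 < η₀ ∧ ∀ (a₀ θ₀ : Literature.MathematicalPhysics.KineticTheory.T3 → ℝ) (u₀ : Literature.MathematicalPhysics.KineticTheory.T3 → Literature.MathematicalPhysics.KineticTheory.V3), Continuous a₀ → Continuous θ₀ → Continuous u₀ → (∀ x, 0 < a₀ x) → (∀ x, 0 < θ₀ x) → ∃ σ₀ : ℝ, 0 < σ₀ ∧ ∀ σ : ℝ, 0 < σ → σ < σ₀ → ∀ Φ : (N : ℕ) → Literature.Analysis.FluidPDE.HardSphereFlow (Literature.Analysis.FluidPDE.Torus.geometry (Fin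 3)) (Literature.MathematicalPhysics.KineticTheory.hsDiameter σ N) (N + 1), ∀ τ : ℝ, 0 < τ → ∀ χ : ℝ × UnitAddTorus (Fin 3) → ℝ, Continuous χ → ∀ g : ℝ → ℝ, Continuous g → (∀ a, η₀ ≤ a → g a = 0) → ∀ Ψ : EuclideanSpace ℝ (Fin 3) × EuclideanSpace ℝ (Fin 3) × EuclideanSpace ℝ (Fin 3) → ℝ, Continuous Ψ → (∃ C : ℝ, ∀ q, |Ψ q| ≤ C) → (∃ R : ℝ, ∀ q, R ≤ ‖q.2.1‖ + ‖q.2.2‖ → Ψ q = 0) → (∀ (n v w : EuclideanSpace ℝ (Fin 3)), ‖n‖ = 1 → Ψ (-n, (Literature.Analysis.FluidPDE.reflectVel n (v, w)).1, (Literature.Analysis.FluidPDE.reflectVel n (v, w)).2) = -Ψ (n, v, w)) → ∀ η δ : ℝ, 0 < η → 0 < δ → ∃ r₀ : ℝ, 0 < r₀ ∧ ∀ r ϑ : ℝ, 0 < r → r < r₀ → 0 < ϑ → ϑ < r₀ → ∃ N₀ : ℕ, ∀ N : ℕ, N₀ ≤ N → let ε := Literature.MathematicalPhysics.KineticTheory.hsDiameter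 σ N; let G := Literature.Analysis.FluidPDE.Torus.geometry (Fin 3); let γ := fun z (s : ℝ) => (Φ N).flow s z; let bx : UnitAddTorus (Fin 3) → UnitAddTorus (Fin 3) → ℝ := fun x y => 3 / (Real.pi * r ^ 3) * max (1 - Literature.Analysis.FluidPDE.Torus.euclidDist x y / r) 0; let ρm := fun z s (x₀ : UnitAddTorus (Fin 3)) => ∫ q, bx q.1 x₀ ∂(Literature.Analysis.FluidPDE.empiricalMeasure (γ z s)); let hm := fun z s (x₀ : UnitAddTorus (Fin 3)) (v : EuclideanSpace ℝ (Fin 3)) => ∫ q, bx q.1 x₀ * Literature.Analysis.FluidPDE.localMaxwellian 1 (ϑ ^ 2) v q.2 ∂(Literature.Analysis.FluidPDE.empiricalMeasure (γ z s)); let pv := fun z s (i j : Fin (N + 1)) => Literature.Analysis.FluidPDE.reflectVel (G.sepVec (γ z s i).1 (γ z s j).1) ((γ z s i).2, (γ z s j).2); let F := fun z s (i j : Fin (N + 1)) => Real.log (hm z s (γ z s i).1 (pv z s i j).1) + Real.log (hm z s (γ z s i).1 (pv z s i j).2) - Real.log (hm z s (γ z s i).1 (γ z s i).2) - Real.log (hm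 z s (γ z s i).1 (γ z s j).2); let Kc := fun (Fn : Literature.Analysis.FluidPDE.Config (N + 1) (Fin 3) Literature.MathematicalPhysics.KineticTheory.T3 → ℝ → Fin (N + 1) → Fin (N + 1) → ℝ) z => ε / (N + 1 : ℝ) * ∑ᶠ (s : ℝ) (_ : s ∈ Literature.Analysis.FluidPDE.collisionTimes G ε (γ z) ∩ Set.Icc 0 τ), ∑ i : Fin (N + 1), ∑ j : Fin (N + 1), (if i ≠ j ∧ ‖G.sepVec (γ z s i).1 (γ z s j).1‖ = ε then Fn z s i j else 0); let D := fun z => Kc (fun z s i j => χ (s, (γ z s i).1) * g (σ ^ 3 * ρm z s (γ z s i).1) * (Ψ (ε⁻¹ • G.sepVec (γ z s i).1 (γ z s j).1, (pv z s i j).1, (pv z s i j).2) * (1 + Real.exp (-F z s i j)))) z; Literature.MathematicalPhysics.KineticTheory.localGibbsLaw σ a₀ u₀ θ₀ N (Φ N) {z | η < |D z|} ≤ ENNReal.ofReal δ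

/-- C′ is weaker than the filed crux: `OddContactSymmetry → OddContactSymmetryCompactMarks` (drop the extra hypothesis).
[folklore] -/
theorem oddContactSymmetry_imp_compactMarks (h : OddContactSymmetry) : OddContactSymmetryCompactMarks := by
  obtain ⟨η₀, hη₀, H⟩ := h
  refine ⟨η₀, hη₀, ?_⟩
  intro a₀ θ₀ u₀ ha hθ hu ha0 hθ0
  obtain ⟨σ₀, hσ₀, H⟩ := H a₀ θ₀ u₀ ha hθ hu ha0 hθ0
  refine ⟨σ₀, hσ₀, ?_⟩
  intro σ hσ hσσ Φ τ hτ χ hχ g hg hg0 Ψ hΨ hΨb _hΨR hΨJ η δ hη hδ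
  exact H σ hσ hσσ Φ τ hτ χ hχ g hg hg0 Ψ hΨ hΨb hΨJ η δ hη hδ

end

end Summit.AtomisticToContinuum.HydrodynamicLimit.Cruxes.OddContactSymmetry.Repair
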